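import Literature.IUT.LogVolume.HullModel
import Literature.IUT.LogVolume.PacketVolume
import Literature.IUT.LogThetaLattice.HolomorphicHull
import HarnessLib

/-!
# [IUTchIII] Remark 3.9.5 (iv) (Ξ3), the printed example, COMPUTED in the model

Mochizuki, [IUTchIII] Rmk. 3.9.5 (iv) (Ξ3), kurims p. 129: the example `I = ℚ_p × ℚ_p`, `H₀ = ℤ_p × ℤ_p`,
`H₁ = (p^{-1}ℤ_p) × (pℤ_p)`, `P = H₀ ∪ ({p^{-1}} × ℤ_p)`, Haar measure with `μ_I(H₀) = 1`: "`μ_I(P) = μ_I(H₀) = 1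
< 2 − p^{-1} = μ_I(H₀ ∪ H₁)`" — exhibiting `P ∈ Preg` with `μ^log(P) < μ^log(H_Ξ(P))`. The layer-L6 file
`Literature/IUT/LogThetaLattice/HolomorphicHull.lean` (abc-iut-L6-t4) types it as the numerical NAMED
statement `Xi3_example p μH0 μH1 μH01 μP` ("`μ(H₀) = μ(H₁) = 1`, `μ(H₀ ∩ H₁) = p^{-1}`, `μ(P) = 1`,
`μ(P) < μ(H₀) + μ(H₁) − μ(H₀ ∩ H₁)`") about four real numbers.

This file DISCHARGES it with ACTUAL volumes: over any nonarchimedean local field `K` (norm presentation)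
with uniformizer `ϖ` and residue cardinality `q` — for `K = ℚ_p`: `ϖ = p`, `q = p` — the four sets in
`K × K` (as boxes in `Fin 2 → K`) have the constructed product volume (`piVolume`, normalised by
`μ(O_K × O_K) = 1`) `μ(H₀) = 1`, `μ(H₁) = q·q^{-1} = 1`, `μ(H₀ ∩ H₁) = q^{-1}`, `μ(P) = 1` (the slice
`{ϖ^{-1}} × O_K` is null), whence `lt_Xi3_example : Xi3_example q μ(H₀) μ(H₁) μ(H₀ ∩ H₁) μ(P)`.
[cite: Mochizuki2012, IUTchIII Rmk. 3.9.5 (iv) p. 129]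
Deliberately NOT here: (Ξ1), (Ξ2); any judgement on [IUTchIII] Cor. 3.12.
-/

noncomputable section

open MeasureTheory Set Metric TopologicalSpace
open scoped ENNReal NNReal Pointwise NormedField
open Literature.NumberTheory.GaloisRepresentations.Ultrametric

namespace Literature.IUT.LogVolume

namespace Xi3

variable (K : Type*) [NontriviallyNormedField K] [IsUltrametricDist K] [ProperSpace K]
  [MeasurableSpace K] [BorelSpace K]

/-- `I = K × K` as a box space `Fin 2 → K`. [cite: Mochizuki2012, IUTchIII Rmk. 3.9.5 (iv) p. 129] -/
abbrev Pair : Fin 2 → Type _ := fun _ => K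

/-- The normalised volume on `K × K` (`μ(O_K × O_K) = 1`). [cite: Mochizuki2012, IUTchIII Rmk. 3.9.5 (iv) p. 129] -/
abbrev vol (S : Set (Π j : Fin 2, Pair K j)) : ℝ := (piVolume (Pair K) S).toReal

/-- `H₀ = O_K × O_K`. [cite: Mochizuki2012, IUTchIII Rmk. 3.9.5 (iv) p. 129] -/
def H0 : Set (Π j : Fin 2, Pair K j) := polydisc (Pair K) ![1, 1]

/-- `H₁ = ϖ^{-1}O_K × ϖO_K`. [cite: Mochizuki2012, IUTchIII Rmk. 3.9.5 (iv) p. 129] -/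
def H1 (ϖ : Kˣ) : Set (Π j : Fin 2, Pair K j) := polydisc (Pair K) ![‖(ϖ : K)‖⁻¹, ‖(ϖ : K)‖]

/-- The null slice `{ϖ^{-1}} × O_K`. [cite: Mochizuki2012, IUTchIII Rmk. 3.9.5 (iv) p. 129] -/
def slice (ϖ : Kˣ) : Set (Π j : Fin 2, Pair K j) :=
  Set.pi univ (fun j : Fin 2 => (![{((ϖ : K)⁻¹ : K)}, closedBall (0 : K) 1] : Fin 2 → Set K) j)

/-- `P = H₀ ∪ ({ϖ^{-1}} × O_K)`. [cite: Mochizuki2012, IUTchIII Rmk. 3.9.5 (iv) p. 129] -/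
def P (ϖ : Kˣ) : Set (Π j : Fin 2, Pair K j) := H0 K ∪ slice K ϖ

variable {K}

/-- The product volume is a Haar measure (instance through the `piVolume` abbreviation).
[cite: Mochizuki2012, IUTchIII Rmk. 3.1.1 (iii) p. 95] -/
instance isAddHaarMeasure_piVolume_pair : Measure.IsAddHaarMeasure (piVolume (Pair K)) := by
  unfold piVolume; infer_instance

/-- `μ(H₀) = 1`. [cite: Mochizuki2012, IUTchIII Rmk. 3.9.5 (iv) p. 129] -/
theorem vol_H0 : vol K (H0 K) = 1 := by
  have : H0 K = polydisc (Pair K) (fun _ => 1) := by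
    unfold H0; congr 1; funext j; fin_cases j <;> rfl
  rw [vol, this, piVolume_unitPolydisc, ENNReal.toReal_one]

/-- `μ_K(ϖO_K) = q^{-1}`. [cite: MochizukiAbsTopIII2015, Prop. 5.7 (i) p. 137] -/
theorem localVolume_real_ball_norm {ϖ : Kˣ} (hϖ : IsUniformizer ϖ) :
    (localVolume K (closedBall (0 : K) ‖(ϖ : K)‖)).toReal = ((residueCard K : ℝ))⁻¹ := by
  have h := localVolume_real_closedBall_zpow K hϖ 1
  rw [zpow_one] at h
  rw [h, zpow_neg, zpow_one]

/-- `μ_K(ϖ^{-1}O_K) = q`. [cite: MochizukiAbsTopIII2015, Prop. 5.7 (i) p. 137] -/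
theorem localVolume_real_ball_inv_norm {ϖ : Kˣ} (hϖ : IsUniformizer ϖ) :
    (localVolume K (closedBall (0 : K) ‖(ϖ : K)‖⁻¹)).toReal = (residueCard K : ℝ) := by
  have h := localVolume_real_closedBall_zpow K hϖ (-1)
  rw [zpow_neg_one] at h
  rw [h, neg_neg, zpow_one]

/-- `μ(H₁) = q · q^{-1} = 1`. [cite: Mochizuki2012, IUTchIII Rmk. 3.9.5 (iv) p. 129] -/
theorem vol_H1 {ϖ : Kˣ} (hϖ : IsUniformizer ϖ) : vol K (H1 K ϖ) = 1 := by
  have hq : (residueCard K : ℝ) ≠ 0 := (lt_trans one_pos (one_lt_residueCard_real K)).ne'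
  rw [vol, H1, piVolume_polydisc, ENNReal.toReal_prod, Fin.prod_univ_two]
  simp only [Matrix.cons_val_zero, Matrix.cons_val_one]
  change (localVolume K (closedBall (0 : K) ‖(ϖ : K)‖⁻¹)).toReal *
    (localVolume K (closedBall (0 : K) ‖(ϖ : K)‖)).toReal = 1
  rw [localVolume_real_ball_inv_norm hϖ, localVolume_real_ball_norm hϖ, mul_inv_cancel₀ hq]

omit [IsUltrametricDist K] [ProperSpace K] [MeasurableSpace K] [BorelSpace K] in
/-- `H₀ ∩ H₁ = O_K × ϖO_K`. [cite: Mochizuki2012, IUTchIII Rmk. 3.9.5 (iv) p. 129] -/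
theorem H0_inter_H1 {ϖ : Kˣ} (hϖ : IsUniformizer ϖ) :
    H0 K ∩ H1 K ϖ = polydisc (Pair K) ![1, ‖(ϖ : K)‖] := by
  unfold H0 H1 polydisc
  rw [← Set.pi_inter_distrib]
  congr 1
  funext j
  fin_cases j
  · -- `O ∩ ϖ^{-1}O = O`
    simp only [Fin.zero_eta, Matrix.cons_val_zero]
    exact Set.inter_eq_left.mpr (closedBall_subset_closedBall
      (one_le_inv_iff₀.mpr ⟨norm_pos_iff.mpr ϖ.ne_zero, hϖ.1.le⟩))
  · -- `O ∩ ϖO = ϖO`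
    simp only [Fin.mk_one, Matrix.cons_val_one, Matrix.cons_val_zero]
    exact Set.inter_eq_right.mpr (closedBall_subset_closedBall hϖ.1.le)

/-- `μ(H₀ ∩ H₁) = q^{-1}`. [cite: Mochizuki2012, IUTchIII Rmk. 3.9.5 (iv) p. 129] -/
theorem vol_H0_inter_H1 {ϖ : Kˣ} (hϖ : IsUniformizer ϖ) :
    vol K (H0 K ∩ H1 K ϖ) = ((residueCard K : ℝ))⁻¹ := by
  rw [vol, H0_inter_H1 hϖ, piVolume_polydisc, ENNReal.toReal_prod, Fin.prod_univ_two]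
  simp only [Matrix.cons_val_zero, Matrix.cons_val_one]
  change (localVolume K (closedBall (0 : K) 1)).toReal *
    (localVolume K (closedBall (0 : K) ‖(ϖ : K)‖)).toReal = _
  rw [localVolume_closedBall_one, ENNReal.toReal_one, one_mul, localVolume_real_ball_norm hϖ]

/-- The slice `{ϖ^{-1}} × O_K` is null. [cite: Mochizuki2012, IUTchIII Rmk. 3.9.5 (iv) p. 129] -/
theorem piVolume_slice (ϖ : Kˣ) : piVolume (Pair K) (slice K ϖ) = 0 := by
  rw [slice, piVolume_eq_pi, Measure.pi_pi, Fin.prod_univ_two]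
  simp only [Matrix.cons_val_zero, Matrix.cons_val_one]
  have h0 : localVolume K ({((ϖ : K)⁻¹ : K)} : Set K) = 0 := by
    rw [show ({((ϖ : K)⁻¹ : K)} : Set K) = ((ϖ : K)⁻¹ : K) +ᵥ ({0} : Set K) by simp,
      localVolume_vadd]
    exact localVolume_singleton_zero (Pair K) (0 : Fin 2)
  rw [h0, zero_mul]

/-- `μ(P) = μ(H₀) = 1`. [cite: Mochizuki2012, IUTchIII Rmk. 3.9.5 (iv) p. 129] -/
theorem vol_P (ϖ : Kˣ) : vol K (P K ϖ) = 1 := by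
  have hle : piVolume (Pair K) (P K ϖ) ≤ piVolume (Pair K) (H0 K) := by
    calc piVolume (Pair K) (P K ϖ) ≤ piVolume (Pair K) (H0 K) + piVolume (Pair K) (slice K ϖ) :=
          measure_union_le _ _
      _ = piVolume (Pair K) (H0 K) := by rw [piVolume_slice, add_zero]
  have hge : piVolume (Pair K) (H0 K) ≤ piVolume (Pair K) (P K ϖ) := measure_mono subset_union_left
  have : piVolume (Pair K) (P K ϖ) = piVolume (Pair K) (H0 K) := le_antisymm hle hge
  rw [vol, this]
  exact vol_H0

/-- **(Ξ3) computed**: L6's named statement `Xi3_example` HOLDS for the actual volumes of the printed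
sets in `K × K` (`K = ℚ_p`: `q = p`): `μ(H₀) = μ(H₁) = 1`, `μ(H₀ ∩ H₁) = q^{-1}`, `μ(P) = 1 < 2 − q^{-1}`.
[cite: Mochizuki2012, IUTchIII Rmk. 3.9.5 (iv) p. 129] -/
theorem lt_Xi3_example {ϖ : Kˣ} (hϖ : IsUniformizer ϖ) :
    LogThetaLattice.Xi3_example (residueCard K) (vol K (H0 K)) (vol K (H1 K ϖ))
      (vol K (H0 K ∩ H1 K ϖ)) (vol K (P K ϖ)) := by
  refine ⟨vol_H0, vol_H1 hϖ, vol_H0_inter_H1 hϖ, vol_P ϖ, ?_⟩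
  rw [vol_P, vol_H0, vol_H1 hϖ, vol_H0_inter_H1 hϖ]
  exact LogThetaLattice.Xi3_example_ineq (two_le_residueCard K)

/-- In particular `μ(P) < μ(H₀ ∪ H₁)` — `P` is a direct product PRE-region whose log-volume is strictly
smaller than that of `H_Ξ(P) ⊇ H₀ ∪ H₁` (inclusion–exclusion for the two boxes).
[cite: Mochizuki2012, IUTchIII Rmk. 3.9.5 (iv) p. 129] -/
theorem vol_P_lt_vol_H0_union_H1 {ϖ : Kˣ} (hϖ : IsUniformizer ϖ) :
    vol K (P K ϖ) < vol K (H0 K ∪ H1 K ϖ) := by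
  have hmeas : MeasurableSet (H1 K ϖ) := by
    unfold H1 polydisc
    exact MeasurableSet.univ_pi fun j => measurableSet_closedBall
  have hfin0 : piVolume (Pair K) (H0 K) ≠ ∞ :=
    ((isBounded_polydisc (Pair K) _).isCompact_closure.measure_lt_top.trans_le'
      (measure_mono subset_closure)).ne
  have hfin1 : piVolume (Pair K) (H1 K ϖ) ≠ ∞ :=
    ((isBounded_polydisc (Pair K) _).isCompact_closure.measure_lt_top.trans_le'
      (measure_mono subset_closure)).ne
  -- inclusion–exclusion: `μ(H₀ ∪ H₁) + μ(H₀ ∩ H₁) = μ(H₀) + μ(H₁)`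
  have hie := measure_union_add_inter (μ := piVolume (Pair K)) (H0 K) hmeas
  have hfinU : piVolume (Pair K) (H0 K ∪ H1 K ϖ) ≠ ∞ := (measure_union_lt_top hfin0.lt_top hfin1.lt_top).ne
  have hfinI : piVolume (Pair K) (H0 K ∩ H1 K ϖ) ≠ ∞ := (lt_of_le_of_lt (measure_mono inter_subset_left)
    hfin0.lt_top).ne
  have hreal := congrArg ENNReal.toReal hie
  rw [ENNReal.toReal_add hfinU hfinI, ENNReal.toReal_add hfin0 hfin1] at hreal
  change vol K (P K ϖ) < vol K (H0 K ∪ H1 K ϖ)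
  have h5 := (lt_Xi3_example (K := K) hϖ).2.2.2.2
  change vol K (H0 K ∪ H1 K ϖ) + vol K (H0 K ∩ H1 K ϖ) = vol K (H0 K) + vol K (H1 K ϖ) at hreal
  linarith

end Xi3

end Literature.IUT.LogVolume
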